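import Summits.BirchSwinnertonDyer.Rank1Residual.Additive.GordCongruentPairGVBudget
import Summits.BirchSwinnertonDyer.Rank1Residual.Additive.CongruentPartnerMainConjectureGordBSD
import Summits.BirchSwinnertonDyer.Rank1Residual.Additive.CongruentPartnerMainConjectureX3GordBSD
import HarnessLib

/-!
# Rank-`0` `BSD(E,p)` ENDS on the (G-ord, `e = 2`) rows from a GV congruent partner of EITHER type
# and enough RANK — X3♯(G-ord) reducible pairs with NEITHER the congruence schema NOR a partner
# certificate as a hypothesis, and the EPW-free second source on X4♯(G-ord) (cell `b2b-bsdres`, team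
# n1011, seat p07 (gen 6); OWNERS row T-E3d-GV FILE 5 (offered to p05 / p10 successor first); sequel
# of `GordCongruentPairGVBudget.lean` over n1011-p10's `CongruentPartnerMainConjecture[X3]GordBSD`)

HONEST FRAMING (cell `b2b-bsdres`, run/shared/lean/b2b/bsd-rank1-residual/, verbatim in every
file): the goal of the cell is to DELETE the COMBINATION-SHAPED residual classes of the
Birch–Swinnerton-Dyer formula for ALL analytic-rank `≤ 1` elliptic curves over `ℚ` — "full BSD
formula for every rank `≤ 1` curve in class `C`" assembled STRICTLY from published theorems — so
that the rank-`≤ 1` remainder becomes exactly the CONSTRUCTION-SHAPED classes, which are TYPED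
(missing-input `Prop`s), NOT attempted. This is not "finishing BSD". Team n1011 (RESIDUAL-MAP §I
N10 / N11 LOWER half on the (G-ord, `e = 2`) rows = X4♯(G-ord) ∩ `I₀*` ∧ surj / X3♯(G-ord) ∩ `I₀*`,
`r_an = 0`, non-CM, non-anomalous, `p ≥ 5` or `p = 3`): research route on CONSTRUCTION-SHAPED
items; labels and marks UNCHANGED; nothing booked — every statement below is PER PAIR modulo the named
facts AND per-pair inputs outside the kernel (the unit-coefficient record `BranchUnitCoeffAt` =
CERTIFICATE-EVIDENCE, two-engine rule; the congruence = census `TorsionIso` currency; `Σ₀`; the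
partner's rank; on X3 one census torsion bit; the row bits ¬CM / non-anomalous); booking = director,
per pair, after countersign. Theorems only; NO definition; NO Literature fact minted. Named facts as
HYPOTHESES exactly as in the consumed ends, none dropped: `hK` (Kato 2004 Thm. 17.4 (3), X4), `hW16`
(Wuthrich 2014 Thm. 16, X3♯), `hDel98` (Delbourgo 1998 Prop. 4), `hDel` / `hDel3` (Delbourgo 2002
Theorem / at `3`), `hPal` (Pal 2012 Thm. 3.2, `p ≥ 5` ends), `hGZK`, `hmod`, `hmodD`; for the GV
budget `hGV` (A240), `hGrK` (A239), `hT40`/`hT41` (A40/A41, (M) partner only). Debt 0.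

## What

n1011-p10's (G-ord) rank-`0` ends `ClassX4Gord.bsdp[_three]_rankZero_of_katoHalf_of_coeffCert_of_budget_of_nonAnomalous[_noPal]`
and `ClassX3Gord.bsdp[_three]_rankZero_of_wuthrichHalf_of_coeffCert_of_budget_of_nonAnomalous` take
the typed budget `BudgetLeLambdaAt p W b` at the index `b` of the unit coefficient. FILE 4
(`GordCongruentPairGVBudget`) produces it from a GV congruent partner of rank `≥ r₁` (either type).
Composed here, `b ≤ r₁ + Σ_{w∈Σ₀} (δ(E₁,w) − δ(E,w))`:
* §1 X4♯(G-ord) ∩ `I₀*` ∧ surj row, `p ≥ 5` (`…_of_gv_of_{gord,mult}Partner_of_nonAnomalous`) and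
  `p = 3` (`bsdp_three_…`, NO Pal binder) — the EPW-free twins of p07-g5's
  `MixedCongruentPartnerEPWBSD` §1–§2;
* §2 X3♯(G-ord) ∩ `I₀*` row (`ρ̄` REDUCIBLE, EPW inapplicable), `p ≥ 5` and `p = 3`, partner X3♯(G-ord)
  or X3♯(M) of rank `≥ r₁` — NO schema hypothesis, NO partner certificate: per pair the inputs are the
  record at `E`, `TorsionIso`, `Σ₀`, `p ∤ #E(ℚ)_tors`, ¬CM, non-anomalous, and `r₁ ≤ rank E₁(ℚ)`.

What is NOT claimed: anomalous rows; `e ∈ {3,4,6}`; semistable partners; `r_an = 1`; `p = 2`.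
X3♯/X4♯(G-ord) stay CONSTRUCTION-SHAPED; nothing booked.

References: Greenberg–Vatsal 2000 §2 [GreenbergVatsal2000]; Kato 2004 Thm. 17.4 (3)
[Kato2004Asterisque]; Wuthrich 2014 Thm. 16 [Wuthrich2014]; Delbourgo 1998 Prop. 4 [Delbourgo1998];
Delbourgo 2002 Theorem, Hypothesis [Delbourgo2002]; Pal 2012 Thm. 3.2 [Pal2012]; Miller 2011 Def. 1.1
[Miller2011LMS]; Greenberg LNM 1716 §2, Prop. 4.14 [GreenbergLNM1716]; Silverman *ATAEC* V.5.3–5.4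
[SilvermanATAEC1994].
-/

set_option autoImplicit false

noncomputable section

open scoped Classical MatrixGroups ModularForm NumberField

open CongruenceSubgroup WeierstrassCurve NumberField IsDedekindDomain Field
  Literature.NumberTheory.EllipticCurves
  Literature.NumberTheory.EllipticCurves.ModularForms
  Literature.NumberTheory.EllipticCurves.Rank1Residual
  Literature.NumberTheory.EllipticCurves.Rank1Residual.Typed
  Literature.NumberTheory.EllipticCurves.GreenbergSelmer
  Literature.NumberTheory.EllipticCurves.Greenberg1999
  Literature.NumberTheory.EllipticCurves.Wuthrich2014
  Literature.NumberTheory.EllipticCurves.GreenbergVatsal2000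
  Literature.NumberTheory.EllipticCurves.Delbourgo2002
  Literature.NumberTheory.GaloisRepresentations
  Summit.BirchSwinnertonDyer.Rank1Residual.X1.MuLambda
  Summit.BirchSwinnertonDyer.Rank1Residual.X11a
  Summit.BirchSwinnertonDyer.Rank1Residual.Iwasawa

open Summit.BirchSwinnertonDyer.Rank1Residual.X1.CongruenceTransfer (TorsionIso CongruentLambdaShift)

namespace Summit.BirchSwinnertonDyer.Rank1Residual.Additive

open Summit.BirchSwinnertonDyer.Rank1Residual.AdditivePotMult
open Summit.BirchSwinnertonDyer.Rank1Residual.Additive.CensusQ6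

variable {W W₁ : WeierstrassCurve ℚ} [W.IsElliptic] [W.IsGloballyMinimal] [W₁.IsElliptic]
  [W₁.IsGloballyMinimal] {p : ℕ} [hp : Fact p.Prime]

/-! ### §1 X4♯(G-ord) ∩ `I₀*` ∧ surj ∧ `r_an = 0` row: `BSD(E,p)` from the record + a GV partner of enough rank -/

/-- **X4♯(G-ord) ∩ `I₀*` ∩ {`ρ̄` onto}, `p ≥ 5`, `r_an = 0`, non-CM, non-anomalous, X4♯(G-ord) ∩ `I₀*`
∧ surj partner of rank `≥ r₁`: `BSD(E,p)` ⟸ ONE unit coefficient at `E` at index `b` + a GV congruent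
partner** (`TorsionIso`, `Σ₀`, `r₁ ≤ rank E₁(ℚ)`, `b ≤ r₁ + Σ(δ₁ − δ)`); p10's `…_of_budget_of_nonAnomalous`
over FILE 4's `ClassX4Gord.budgetLeLambdaAt_of_gv_of_gordPartner_of_rank`. The EPW-free twin of g5's
`…_of_epw_of_gordPartner_of_nonAnomalous`. PER PAIR; nothing booked.
[cite: Delbourgo2002, Theorem (A), (B) (p. 40)] [cite: Kato2004Asterisque, Thm. 17.4 (3) (p. 273)]
[cite: GreenbergVatsal2000, §2 Prop. (2.8) with Remark (2.9), Cor. (2.3), Prop. (2.4), pp. 26–27 (arXiv:math/9906215)]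
[cite: Delbourgo1998, Prop. 4 (p. 144)] [cite: Pal2012, Thm. 3.2] [cite: Miller2011LMS, §1 and Def. 1.1] -/
theorem ClassX4Gord.bsdp_rankZero_of_katoHalf_of_coeffCert_of_gv_of_gordPartner_of_nonAnomalous
    (hK : Wuthrich2014.kato_halfEigenCharIdeal_dvd_cyclotomicPrime_of_surjective)
    (hPal : Pal2012.thm32_sqrt_mul_realPeriodRat_twist_eq_of_prime_one_mod_four)
    (hDel98 : Delbourgo1998.prop4_rankZero_pow_dvd_constantCoeff) (hDel : Delbourgo2002.mainTheorem)
    (hGZK : rank_eq_analyticRank_of_analyticRank_le_one) (hmod : hasEntireLFunction_rat)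
    (hmodD : nonempty_modularParametrizationData)
    (hGV : muLambdaAlg_transfer_of_torsionIso_potOrd_of_not_dvd_torsionOrder)
    (hGrK : imKummer_ge_strictCondition_goodOrdinary)
    (hX : ClassX4Gord W p) (hcm : ¬ W.HasCM) (hp5 : 5 ≤ p) (he : semistabilityIndex W p = 2)
    (hsurj : Surj W p) (hr : W.analyticRank = 0) {b : ℕ} (hcert : BranchUnitCoeffAt W p b)
    (hna : ReductionNonAnomalous W p)
    (hX₁ : ClassX4Gord W₁ p) (he₁ : semistabilityIndex W₁ p = 2) (hsurj₁ : Surj W₁ p) {r₁ : ℕ}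
    (hr₁ : r₁ ≤ W₁.mordellWeilRank) (hT : TorsionIso W W₁ p)
    (S₀ : Finset (HeightOneSpectrum (𝓞 ℚ))) (hS₀ : ∀ w ∈ S₀, ((p : ℕ) : 𝓞 ℚ) ∉ w.asIdeal)
    (hS : ∀ w : HeightOneSpectrum (𝓞 ℚ), w ∉ S₀ → ((p : ℕ) : 𝓞 ℚ) ∉ w.asIdeal →
      W.HasGoodReductionAt w)
    (hS₁ : ∀ w : HeightOneSpectrum (𝓞 ℚ), w ∉ S₀ → ((p : ℕ) : 𝓞 ℚ) ∉ w.asIdeal →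
      W₁.HasGoodReductionAt w)
    (hb : (b : ℤ) ≤ r₁ + ∑ w ∈ S₀, ((delta W₁ p w : ℤ) - (delta W p w : ℤ))) : BSDp W p :=
  hX.bsdp_rankZero_of_katoHalf_of_coeffCert_of_budget_of_nonAnomalous hK hPal hDel98 hDel hGZK hmod
    hmodD hcm hp5 he hsurj hr hcert
    (hX.budgetLeLambdaAt_of_gv_of_gordPartner_of_rank hGV hGrK hK hmodD he hX₁ he₁ hsurj₁ hr₁ hT S₀ hS₀
      hS hS₁ hb) hna

/-- **X4♯(G-ord) ∩ `I₀*` ∩ {`ρ̄` onto}, `p ≥ 5`, `r_an = 0`, non-CM, non-anomalous, X4(M) ∧ surj partner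
of rank `≥ r₁`: `BSD(E,p)` ⟸ ONE unit coefficient at `E` + a GV congruent partner**, mod `hGrK` |
A40/A41; p10's `…_of_budget_of_nonAnomalous` over FILE 4's
`ClassX4Gord.budgetLeLambdaAt_of_gv_of_multPartner_of_rank`. The EPW-free twin of g5's
`…_of_epw_of_multPartner_of_nonAnomalous`. PER PAIR; nothing booked.
[cite: Delbourgo2002, Theorem (A), (B) (p. 40)] [cite: Kato2004Asterisque, Thm. 17.4 (3) (p. 273)]
[cite: GreenbergVatsal2000, §2 Prop. (2.8) with Remark (2.9), Cor. (2.3), Prop. (2.4), pp. 26–27 (arXiv:math/9906215)]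
[cite: Delbourgo1998, Prop. 4 (p. 144)] [cite: Pal2012, Thm. 3.2] [cite: Miller2011LMS, Def. 1.1]
[cite: SilvermanATAEC1994, Ch. V Thm. 5.3, Cor. 5.4] -/
theorem ClassX4Gord.bsdp_rankZero_of_katoHalf_of_coeffCert_of_gv_of_multPartner_of_nonAnomalous
    (hK : Wuthrich2014.kato_halfEigenCharIdeal_dvd_cyclotomicPrime_of_surjective)
    (hPal : Pal2012.thm32_sqrt_mul_realPeriodRat_twist_eq_of_prime_one_mod_four)
    (hDel98 : Delbourgo1998.prop4_rankZero_pow_dvd_constantCoeff) (hDel : Delbourgo2002.mainTheorem)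
    (hGZK : rank_eq_analyticRank_of_analyticRank_le_one) (hmod : hasEntireLFunction_rat)
    (hmodD : nonempty_modularParametrizationData)
    (hGV : muLambdaAlg_transfer_of_torsionIso_potOrd_of_not_dvd_torsionOrder)
    (hGrK : imKummer_ge_strictCondition_goodOrdinary)
    (hT40 : Silverman1994_thmV53_tateUniformisation.{0})
    (hT41 : Silverman1994_thmV53_corV54_tateUniformisation.{0})
    (hX : ClassX4Gord W p) (hcm : ¬ W.HasCM) (hp5 : 5 ≤ p) (he : semistabilityIndex W p = 2)
    (hsurj : Surj W p) (hr : W.analyticRank = 0) {b : ℕ} (hcert : BranchUnitCoeffAt W p b)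
    (hna : ReductionNonAnomalous W p)
    (hX₁ : ClassX4M W₁ p) (hsurj₁ : Surj W₁ p) {r₁ : ℕ} (hr₁ : r₁ ≤ W₁.mordellWeilRank)
    (hT : TorsionIso W W₁ p)
    (S₀ : Finset (HeightOneSpectrum (𝓞 ℚ))) (hS₀ : ∀ w ∈ S₀, ((p : ℕ) : 𝓞 ℚ) ∉ w.asIdeal)
    (hS : ∀ w : HeightOneSpectrum (𝓞 ℚ), w ∉ S₀ → ((p : ℕ) : 𝓞 ℚ) ∉ w.asIdeal →
      W.HasGoodReductionAt w)
    (hS₁ : ∀ w : HeightOneSpectrum (𝓞 ℚ), w ∉ S₀ → ((p : ℕ) : 𝓞 ℚ) ∉ w.asIdeal →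
      W₁.HasGoodReductionAt w)
    (hb : (b : ℤ) ≤ r₁ + ∑ w ∈ S₀, ((delta W₁ p w : ℤ) - (delta W p w : ℤ))) : BSDp W p :=
  hX.bsdp_rankZero_of_katoHalf_of_coeffCert_of_budget_of_nonAnomalous hK hPal hDel98 hDel hGZK hmod
    hmodD hcm hp5 he hsurj hr hcert
    (hX.budgetLeLambdaAt_of_gv_of_multPartner_of_rank hGV hGrK hK hmodD hT40 hT41 he hX₁ hsurj₁ hr₁ hT
      S₀ hS₀ hS hS₁ hb) hna

/-- **X4♯(G-ord) at `3` (`I₀*` automatic) ∧ surj(3), `r_an = 0`, non-CM, non-anomalous, X4♯(G-ord)@3 ∧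
surj(3) partner of rank `≥ r₁`: `BSD(E,3)` ⟸ ONE 3-adic unit coefficient at `E` + a GV congruent
partner**; NO Pal binder (p10's `…_noPal` end). PER PAIR; nothing booked.
[cite: Delbourgo2002, Theorem (A), (B) (p. 40), Hypothesis (p. 39)] [cite: Kato2004Asterisque, Thm. 17.4 (3) (p. 273)]
[cite: GreenbergVatsal2000, §2 Prop. (2.8) with Remark (2.9), pp. 26–27 (arXiv:math/9906215)]
[cite: Delbourgo1998, Prop. 4 (p. 144)] [cite: Miller2011LMS, Def. 1.1] -/
theorem ClassX4Gord.bsdp_three_rankZero_of_katoHalf_of_coeffCert_of_gv_of_gordPartner_of_nonAnomalous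
    [Fact (Nat.Prime 3)]
    (hK : Wuthrich2014.kato_halfEigenCharIdeal_dvd_cyclotomicPrime_of_surjective)
    (hDel98 : Delbourgo1998.prop4_rankZero_pow_dvd_constantCoeff)
    (hDel3 : Delbourgo2002.mainTheorem_three)
    (hGZK : rank_eq_analyticRank_of_analyticRank_le_one) (hmod : hasEntireLFunction_rat)
    (hmodD : nonempty_modularParametrizationData)
    (hGV : muLambdaAlg_transfer_of_torsionIso_potOrd_of_not_dvd_torsionOrder)
    (hGrK : imKummer_ge_strictCondition_goodOrdinary)
    (hX : ClassX4Gord W 3) (hcm : ¬ W.HasCM) (hsurj : Surj W 3) (hr : W.analyticRank = 0) {b : ℕ}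
    (hcert : BranchUnitCoeffAt W 3 b) (hna : ReductionNonAnomalous W 3)
    (hX₁ : ClassX4Gord W₁ 3) (hsurj₁ : Surj W₁ 3) {r₁ : ℕ} (hr₁ : r₁ ≤ W₁.mordellWeilRank)
    (hT : TorsionIso W W₁ 3)
    (S₀ : Finset (HeightOneSpectrum (𝓞 ℚ))) (hS₀ : ∀ w ∈ S₀, ((3 : ℕ) : 𝓞 ℚ) ∉ w.asIdeal)
    (hS : ∀ w : HeightOneSpectrum (𝓞 ℚ), w ∉ S₀ → ((3 : ℕ) : 𝓞 ℚ) ∉ w.asIdeal →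
      W.HasGoodReductionAt w)
    (hS₁ : ∀ w : HeightOneSpectrum (𝓞 ℚ), w ∉ S₀ → ((3 : ℕ) : 𝓞 ℚ) ∉ w.asIdeal →
      W₁.HasGoodReductionAt w)
    (hb : (b : ℤ) ≤ r₁ + ∑ w ∈ S₀, ((delta W₁ 3 w : ℤ) - (delta W 3 w : ℤ))) : BSDp W 3 :=
  have he : semistabilityIndex W 3 = 2 :=
    semistabilityIndex_eq_two_of_typeG_three W hX.typeGOrd.typeG hX.addv.2
  have he₁ : semistabilityIndex W₁ 3 = 2 :=
    semistabilityIndex_eq_two_of_typeG_three W₁ hX₁.typeGOrd.typeG hX₁.addv.2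
  hX.bsdp_three_rankZero_of_katoHalf_of_coeffCert_of_budget_of_nonAnomalous_noPal hK hDel98 hDel3 hGZK
    hmod hmodD hcm hsurj hr hcert
    (hX.budgetLeLambdaAt_of_gv_of_gordPartner_of_rank hGV hGrK hK hmodD he hX₁ he₁ hsurj₁ hr₁ hT S₀ hS₀
      hS hS₁ hb) hna

/-- **X4♯(G-ord) at `3` ∧ surj(3), `r_an = 0`, non-CM, non-anomalous, X4(M) ∧ surj(3) partner of rank
`≥ r₁`: `BSD(E,3)` ⟸ ONE 3-adic unit coefficient at `E` + a GV congruent partner**, mod `hGrK` |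
A40/A41; NO Pal binder. PER PAIR; nothing booked.
[cite: Delbourgo2002, Theorem (A), (B) (p. 40), Hypothesis (p. 39)] [cite: Kato2004Asterisque, Thm. 17.4 (3) (p. 273)]
[cite: GreenbergVatsal2000, §2 Prop. (2.8) with Remark (2.9), pp. 26–27 (arXiv:math/9906215)]
[cite: Delbourgo1998, Prop. 4 (p. 144)] [cite: Miller2011LMS, Def. 1.1] [cite: SilvermanATAEC1994, Ch. V Thm. 5.3] -/
theorem ClassX4Gord.bsdp_three_rankZero_of_katoHalf_of_coeffCert_of_gv_of_multPartner_of_nonAnomalous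
    [Fact (Nat.Prime 3)]
    (hK : Wuthrich2014.kato_halfEigenCharIdeal_dvd_cyclotomicPrime_of_surjective)
    (hDel98 : Delbourgo1998.prop4_rankZero_pow_dvd_constantCoeff)
    (hDel3 : Delbourgo2002.mainTheorem_three)
    (hGZK : rank_eq_analyticRank_of_analyticRank_le_one) (hmod : hasEntireLFunction_rat)
    (hmodD : nonempty_modularParametrizationData)
    (hGV : muLambdaAlg_transfer_of_torsionIso_potOrd_of_not_dvd_torsionOrder)
    (hGrK : imKummer_ge_strictCondition_goodOrdinary)
    (hT40 : Silverman1994_thmV53_tateUniformisation.{0})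
    (hT41 : Silverman1994_thmV53_corV54_tateUniformisation.{0})
    (hX : ClassX4Gord W 3) (hcm : ¬ W.HasCM) (hsurj : Surj W 3) (hr : W.analyticRank = 0) {b : ℕ}
    (hcert : BranchUnitCoeffAt W 3 b) (hna : ReductionNonAnomalous W 3)
    (hX₁ : ClassX4M W₁ 3) (hsurj₁ : Surj W₁ 3) {r₁ : ℕ} (hr₁ : r₁ ≤ W₁.mordellWeilRank)
    (hT : TorsionIso W W₁ 3)
    (S₀ : Finset (HeightOneSpectrum (𝓞 ℚ))) (hS₀ : ∀ w ∈ S₀, ((3 : ℕ) : 𝓞 ℚ) ∉ w.asIdeal)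
    (hS : ∀ w : HeightOneSpectrum (𝓞 ℚ), w ∉ S₀ → ((3 : ℕ) : 𝓞 ℚ) ∉ w.asIdeal →
      W.HasGoodReductionAt w)
    (hS₁ : ∀ w : HeightOneSpectrum (𝓞 ℚ), w ∉ S₀ → ((3 : ℕ) : 𝓞 ℚ) ∉ w.asIdeal →
      W₁.HasGoodReductionAt w)
    (hb : (b : ℤ) ≤ r₁ + ∑ w ∈ S₀, ((delta W₁ 3 w : ℤ) - (delta W 3 w : ℤ))) : BSDp W 3 :=
  have he : semistabilityIndex W 3 = 2 :=
    semistabilityIndex_eq_two_of_typeG_three W hX.typeGOrd.typeG hX.addv.2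
  hX.bsdp_three_rankZero_of_katoHalf_of_coeffCert_of_budget_of_nonAnomalous_noPal hK hDel98 hDel3 hGZK
    hmod hmodD hcm hsurj hr hcert
    (hX.budgetLeLambdaAt_of_gv_of_multPartner_of_rank hGV hGrK hK hmodD hT40 hT41 he hX₁ hsurj₁ hr₁ hT
      S₀ hS₀ hS hS₁ hb) hna

/-! ### §2 X3♯(G-ord) ∩ `I₀*` ∧ `r_an = 0` row (`ρ̄` REDUCIBLE): `BSD(E,p)` from the record + a GV partner of enough rank -/

/-- **X3♯(G-ord) ∩ `I₀*`, `p ≥ 5`, `r_an = 0`, non-CM, non-anomalous, X3♯(G-ord) ∩ `I₀*` partner of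
rank `≥ r₁`: `BSD(E,p)` ⟸ ONE unit coefficient at `E` at index `b` + a GV congruent partner** —
`TorsionIso`, `Σ₀`, ONE census bit `p ∤ #E(ℚ)_tors`, `r₁ ≤ rank E₁(ℚ)`, `b ≤ r₁ + Σ(δ₁ − δ)`; NO
schema hypothesis, NO partner certificate, NO image hypothesis (p10's `…_of_budget_of_nonAnomalous`
over FILE 4's `ClassX3Gord.budgetLeLambdaAt_of_gv_of_gordPartner_of_rank`). PER PAIR; X3♯(G-ord) stays
CONSTRUCTION-SHAPED; nothing booked. [cite: Wuthrich2014, Thm. 16 (p. 397)]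
[cite: Delbourgo2002, Theorem (A), (B) (p. 40)]
[cite: GreenbergVatsal2000, §2 Prop. (2.8) with Remark (2.9), Cor. (2.3), Prop. (2.4), pp. 26–27 (arXiv:math/9906215)]
[cite: Delbourgo1998, Prop. 4 (p. 144)] [cite: Pal2012, Thm. 3.2] [cite: Miller2011LMS, §1 and Def. 1.1]
[cite: GreenbergLNM1716, Prop. 4.14, §2 Props. 2.2, 2.4] -/
theorem ClassX3Gord.bsdp_rankZero_of_wuthrichHalf_of_coeffCert_of_gv_of_gordPartner_of_nonAnomalous
    (hW16 : Wuthrich2014.thm16_halfEigenCharIdeal_dvd_cyclotomicPrime)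
    (hPal : Pal2012.thm32_sqrt_mul_realPeriodRat_twist_eq_of_prime_one_mod_four)
    (hDel98 : Delbourgo1998.prop4_rankZero_pow_dvd_constantCoeff) (hDel : Delbourgo2002.mainTheorem)
    (hGZK : rank_eq_analyticRank_of_analyticRank_le_one) (hmod : hasEntireLFunction_rat)
    (hmodD : nonempty_modularParametrizationData)
    (hGV : muLambdaAlg_transfer_of_torsionIso_potOrd_of_not_dvd_torsionOrder)
    (hGrK : imKummer_ge_strictCondition_goodOrdinary)
    (hX : ClassX3Gord W p) (hcm : ¬ W.HasCM) (hp5 : 5 ≤ p) (he : semistabilityIndex W p = 2)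
    (hr : W.analyticRank = 0) {b : ℕ} (hcert : BranchUnitCoeffAt W p b)
    (hna : ReductionNonAnomalous W p)
    (hX₁ : ClassX3Gord W₁ p) (he₁ : semistabilityIndex W₁ p = 2) {r₁ : ℕ}
    (hr₁ : r₁ ≤ W₁.mordellWeilRank) (htors : ¬ p ∣ W.torsionOrder) (hT : TorsionIso W W₁ p)
    (S₀ : Finset (HeightOneSpectrum (𝓞 ℚ))) (hS₀ : ∀ w ∈ S₀, ((p : ℕ) : 𝓞 ℚ) ∉ w.asIdeal)
    (hS : ∀ w : HeightOneSpectrum (𝓞 ℚ), w ∉ S₀ → ((p : ℕ) : 𝓞 ℚ) ∉ w.asIdeal →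
      W.HasGoodReductionAt w)
    (hS₁ : ∀ w : HeightOneSpectrum (𝓞 ℚ), w ∉ S₀ → ((p : ℕ) : 𝓞 ℚ) ∉ w.asIdeal →
      W₁.HasGoodReductionAt w)
    (hb : (b : ℤ) ≤ r₁ + ∑ w ∈ S₀, ((delta W₁ p w : ℤ) - (delta W p w : ℤ))) : BSDp W p :=
  hX.bsdp_rankZero_of_wuthrichHalf_of_coeffCert_of_budget_of_nonAnomalous hW16 hPal hDel98 hDel hGZK
    hmod hmodD hcm hp5 he hr hcert
    (hX.budgetLeLambdaAt_of_gv_of_gordPartner_of_rank hGV hGrK hW16 hmodD (by omega) he hX₁ he₁ hr₁ htors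
      hT S₀ hS₀ hS hS₁ hb) hna

/-- **X3♯(G-ord) ∩ `I₀*`, `p ≥ 5`, `r_an = 0`, non-CM, non-anomalous, X3♯(M) partner of rank `≥ r₁`:
`BSD(E,p)` ⟸ ONE unit coefficient at `E` + a GV congruent partner**, mod `hGrK` | A40/A41; NO schema
hypothesis, NO partner certificate. PER PAIR; nothing booked. [cite: Wuthrich2014, Thm. 16 (p. 397)]
[cite: Delbourgo2002, Theorem (A), (B) (p. 40)]
[cite: GreenbergVatsal2000, §2 Prop. (2.8) with Remark (2.9), Cor. (2.3), Prop. (2.4), pp. 26–27 (arXiv:math/9906215)]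
[cite: Delbourgo1998, Prop. 4 (p. 144)] [cite: Pal2012, Thm. 3.2] [cite: Miller2011LMS, Def. 1.1]
[cite: SilvermanATAEC1994, Ch. V Thm. 5.3, Cor. 5.4] -/
theorem ClassX3Gord.bsdp_rankZero_of_wuthrichHalf_of_coeffCert_of_gv_of_multPartner_of_nonAnomalous
    (hW16 : Wuthrich2014.thm16_halfEigenCharIdeal_dvd_cyclotomicPrime)
    (hPal : Pal2012.thm32_sqrt_mul_realPeriodRat_twist_eq_of_prime_one_mod_four)
    (hDel98 : Delbourgo1998.prop4_rankZero_pow_dvd_constantCoeff) (hDel : Delbourgo2002.mainTheorem)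
    (hGZK : rank_eq_analyticRank_of_analyticRank_le_one) (hmod : hasEntireLFunction_rat)
    (hmodD : nonempty_modularParametrizationData)
    (hGV : muLambdaAlg_transfer_of_torsionIso_potOrd_of_not_dvd_torsionOrder)
    (hGrK : imKummer_ge_strictCondition_goodOrdinary)
    (hT40 : Silverman1994_thmV53_tateUniformisation.{0})
    (hT41 : Silverman1994_thmV53_corV54_tateUniformisation.{0})
    (hX : ClassX3Gord W p) (hcm : ¬ W.HasCM) (hp5 : 5 ≤ p) (he : semistabilityIndex W p = 2)
    (hr : W.analyticRank = 0) {b : ℕ} (hcert : BranchUnitCoeffAt W p b)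
    (hna : ReductionNonAnomalous W p)
    (hX₁ : ClassX3M W₁ p) {r₁ : ℕ} (hr₁ : r₁ ≤ W₁.mordellWeilRank) (htors : ¬ p ∣ W.torsionOrder)
    (hT : TorsionIso W W₁ p)
    (S₀ : Finset (HeightOneSpectrum (𝓞 ℚ))) (hS₀ : ∀ w ∈ S₀, ((p : ℕ) : 𝓞 ℚ) ∉ w.asIdeal)
    (hS : ∀ w : HeightOneSpectrum (𝓞 ℚ), w ∉ S₀ → ((p : ℕ) : 𝓞 ℚ) ∉ w.asIdeal →
      W.HasGoodReductionAt w)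
    (hS₁ : ∀ w : HeightOneSpectrum (𝓞 ℚ), w ∉ S₀ → ((p : ℕ) : 𝓞 ℚ) ∉ w.asIdeal →
      W₁.HasGoodReductionAt w)
    (hb : (b : ℤ) ≤ r₁ + ∑ w ∈ S₀, ((delta W₁ p w : ℤ) - (delta W p w : ℤ))) : BSDp W p :=
  hX.bsdp_rankZero_of_wuthrichHalf_of_coeffCert_of_budget_of_nonAnomalous hW16 hPal hDel98 hDel hGZK
    hmod hmodD hcm hp5 he hr hcert
    (hX.budgetLeLambdaAt_of_gv_of_multPartner_of_rank hGV hGrK hW16 hmodD hT40 hT41 he hX₁ hr₁ htors hT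
      S₀ hS₀ hS hS₁ hb) hna

/-- **X3♯(G-ord) at `3` (`I₀*` automatic), `r_an = 0`, non-CM, non-anomalous, X3♯(G-ord)@3 partner of
rank `≥ r₁`: `BSD(E,3)` ⟸ ONE 3-adic unit coefficient at `E` + a GV congruent partner** (`E[3] ≅ E₁[3]`,
`3 ∤ #E(ℚ)_tors`, `Σ₀`, `r₁ ≤ rank E₁(ℚ)`); NO Pal binder, NO schema hypothesis, NO partner certificate.
[cite: Wuthrich2014, Thm. 16 (p. 397)] [cite: Delbourgo2002, Theorem (A), (B) (p. 40), Hypothesis (p. 39)]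
[cite: GreenbergVatsal2000, §2 Prop. (2.8) with Remark (2.9), pp. 26–27 (arXiv:math/9906215)]
[cite: Delbourgo1998, Prop. 4 (p. 144)] [cite: Miller2011LMS, Def. 1.1] -/
theorem ClassX3Gord.bsdp_three_rankZero_of_wuthrichHalf_of_coeffCert_of_gv_of_gordPartner_of_nonAnomalous
    [Fact (Nat.Prime 3)]
    (hW16 : Wuthrich2014.thm16_halfEigenCharIdeal_dvd_cyclotomicPrime)
    (hDel98 : Delbourgo1998.prop4_rankZero_pow_dvd_constantCoeff)
    (hDel3 : Delbourgo2002.mainTheorem_three)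
    (hGZK : rank_eq_analyticRank_of_analyticRank_le_one) (hmod : hasEntireLFunction_rat)
    (hmodD : nonempty_modularParametrizationData)
    (hGV : muLambdaAlg_transfer_of_torsionIso_potOrd_of_not_dvd_torsionOrder)
    (hGrK : imKummer_ge_strictCondition_goodOrdinary)
    (hX : ClassX3Gord W 3) (hcm : ¬ W.HasCM) (hr : W.analyticRank = 0) {b : ℕ}
    (hcert : BranchUnitCoeffAt W 3 b) (hna : ReductionNonAnomalous W 3)
    (hX₁ : ClassX3Gord W₁ 3) {r₁ : ℕ} (hr₁ : r₁ ≤ W₁.mordellWeilRank) (htors : ¬ 3 ∣ W.torsionOrder)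
    (hT : TorsionIso W W₁ 3)
    (S₀ : Finset (HeightOneSpectrum (𝓞 ℚ))) (hS₀ : ∀ w ∈ S₀, ((3 : ℕ) : 𝓞 ℚ) ∉ w.asIdeal)
    (hS : ∀ w : HeightOneSpectrum (𝓞 ℚ), w ∉ S₀ → ((3 : ℕ) : 𝓞 ℚ) ∉ w.asIdeal →
      W.HasGoodReductionAt w)
    (hS₁ : ∀ w : HeightOneSpectrum (𝓞 ℚ), w ∉ S₀ → ((3 : ℕ) : 𝓞 ℚ) ∉ w.asIdeal →
      W₁.HasGoodReductionAt w)
    (hb : (b : ℤ) ≤ r₁ + ∑ w ∈ S₀, ((delta W₁ 3 w : ℤ) - (delta W 3 w : ℤ))) : BSDp W 3 :=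
  have he : semistabilityIndex W 3 = 2 :=
    semistabilityIndex_eq_two_of_typeG_three W hX.typeGOrd.typeG hX.addv
  have he₁ : semistabilityIndex W₁ 3 = 2 :=
    semistabilityIndex_eq_two_of_typeG_three W₁ hX₁.typeGOrd.typeG hX₁.addv
  hX.bsdp_three_rankZero_of_wuthrichHalf_of_coeffCert_of_budget_of_nonAnomalous hW16 hDel98 hDel3 hGZK
    hmod hmodD hcm hr hcert
    (hX.budgetLeLambdaAt_of_gv_of_gordPartner_of_rank hGV hGrK hW16 hmodD (by decide) he hX₁ he₁ hr₁
      htors hT S₀ hS₀ hS hS₁ hb) hna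

/-- **X3♯(G-ord) at `3`, `r_an = 0`, non-CM, non-anomalous, X3♯(M)@3 partner of rank `≥ r₁`: `BSD(E,3)`
⟸ ONE 3-adic unit coefficient at `E` + a GV congruent partner**, mod `hGrK` | A40/A41; NO Pal binder,
NO schema hypothesis, NO partner certificate. [cite: Wuthrich2014, Thm. 16 (p. 397)]
[cite: Delbourgo2002, Theorem (A), (B) (p. 40), Hypothesis (p. 39)]
[cite: GreenbergVatsal2000, §2 Prop. (2.8) with Remark (2.9), pp. 26–27 (arXiv:math/9906215)]
[cite: Delbourgo1998, Prop. 4 (p. 144)] [cite: Miller2011LMS, Def. 1.1] [cite: SilvermanATAEC1994, Ch. V Thm. 5.3] -/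
theorem ClassX3Gord.bsdp_three_rankZero_of_wuthrichHalf_of_coeffCert_of_gv_of_multPartner_of_nonAnomalous
    [Fact (Nat.Prime 3)]
    (hW16 : Wuthrich2014.thm16_halfEigenCharIdeal_dvd_cyclotomicPrime)
    (hDel98 : Delbourgo1998.prop4_rankZero_pow_dvd_constantCoeff)
    (hDel3 : Delbourgo2002.mainTheorem_three)
    (hGZK : rank_eq_analyticRank_of_analyticRank_le_one) (hmod : hasEntireLFunction_rat)
    (hmodD : nonempty_modularParametrizationData)
    (hGV : muLambdaAlg_transfer_of_torsionIso_potOrd_of_not_dvd_torsionOrder)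
    (hGrK : imKummer_ge_strictCondition_goodOrdinary)
    (hT40 : Silverman1994_thmV53_tateUniformisation.{0})
    (hT41 : Silverman1994_thmV53_corV54_tateUniformisation.{0})
    (hX : ClassX3Gord W 3) (hcm : ¬ W.HasCM) (hr : W.analyticRank = 0) {b : ℕ}
    (hcert : BranchUnitCoeffAt W 3 b) (hna : ReductionNonAnomalous W 3)
    (hX₁ : ClassX3M W₁ 3) {r₁ : ℕ} (hr₁ : r₁ ≤ W₁.mordellWeilRank) (htors : ¬ 3 ∣ W.torsionOrder)
    (hT : TorsionIso W W₁ 3)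
    (S₀ : Finset (HeightOneSpectrum (𝓞 ℚ))) (hS₀ : ∀ w ∈ S₀, ((3 : ℕ) : 𝓞 ℚ) ∉ w.asIdeal)
    (hS : ∀ w : HeightOneSpectrum (𝓞 ℚ), w ∉ S₀ → ((3 : ℕ) : 𝓞 ℚ) ∉ w.asIdeal →
      W.HasGoodReductionAt w)
    (hS₁ : ∀ w : HeightOneSpectrum (𝓞 ℚ), w ∉ S₀ → ((3 : ℕ) : 𝓞 ℚ) ∉ w.asIdeal →
      W₁.HasGoodReductionAt w)
    (hb : (b : ℤ) ≤ r₁ + ∑ w ∈ S₀, ((delta W₁ 3 w : ℤ) - (delta W 3 w : ℤ))) : BSDp W 3 :=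
  have he : semistabilityIndex W 3 = 2 :=
    semistabilityIndex_eq_two_of_typeG_three W hX.typeGOrd.typeG hX.addv
  hX.bsdp_three_rankZero_of_wuthrichHalf_of_coeffCert_of_budget_of_nonAnomalous hW16 hDel98 hDel3 hGZK
    hmod hmodD hcm hr hcert
    (hX.budgetLeLambdaAt_of_gv_of_multPartner_of_rank hGV hGrK hW16 hmodD hT40 hT41 he hX₁ hr₁ htors hT
      S₀ hS₀ hS hS₁ hb) hna

end Summit.BirchSwinnertonDyer.Rank1Residual.Additive

end
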